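import Literature.AlgebraicGeometry.GroupSchemes.GroupSchemeKernel
import Literature.AlgebraicGeometry.Morphisms.ContainmentLocusFiniteFlat
import Mathlib.AlgebraicGeometry.Morphisms.Finite
import HarnessLib

/-!
# `Ker φ = Eq(φ, 1)`: «`φ_T = 1`» ⟺ «`G_T ⊆ (Ker φ)_T`», a closed condition on the base for a finite flat source

Topic `Literature/AlgebraicGeometry/GroupSchemes`; theorems only (no definition, no named fact, no instance, no notation,
no `sorry`).  Cell hodgecm-mathlib, F-DAG (h6) (β) (B-plan1 (g15) 05:01:13Z), paired with ★
`GroupSchemes/GroupSchemeKernel` (the kernel OBJECT `ker φ = G ×_{H,e} S`, `kerι`, `kerLift`; [GortzWedhorn2020] Def. 4.45 (2))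
and `GroupSchemes/GroupSchemeKernelBaseChange` (its base change, B-typ03 (g16)); the LOCI are ★ `Morphisms/EqualizerLocusClosed`,
★ `Morphisms/ContainmentLocusClosed`, ★ `Morphisms/ContainmentLocusFiniteFlat`.  HC_CM is proved only modulo the 7 printed
citations until rung 0 closes; nothing here is about HC.

For `S`-schemes `G H : Over S`, `H` an `S`-group scheme (`[GrpObj H]`), and an `S`-morphism `φ : G ⟶ H`:

* §1 **`eq_one_iff_isIso_kerι`** (`φ = 1 ↔ Ker φ ⟶ G` is an isomorphism), `isFinite_ker_hom` (`Ker φ → S` is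
  finite for `G → S` finite and `H → S` separated — a closed subgroup scheme of `G`, ★ `isClosedImmersion_kerι_left_of_isSeparated`);
* §2 **`kerι_ker_eq_equalizer_ι_ker`** — the closed subschemes `Ker φ` and `Eq(φ, 1)` of `G` have the SAME ideal sheaf (same
  functor of points: `h ≫ φ = h ≫ 1 = 1`), so «`G_T ⊆ (Ker φ)_T`» IS the containment functor of ★ `EqualizerLocusClosed` at
  `(φ, 1)`: **`pullback_map_eq_map_one_iff_kerι_ker_le`** (`φ_T = 1_T ↔ 𝓘_{Ker φ} ≤ (G ×_S T ⟶ G).ker`), `eq_one_iff_kerι_ker_eq_bot`;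
* §3 for `G → S` FINITE AND FLAT over a locally noetherian `S` (or affine with finite projective charts) and `H → S` separated:
  **`exists_idealSheafData_iff_kerι_ker_le_of_isFinite_of_flat`** — ONE closed subscheme `V(E) ⊆ S` with
  `E ≤ b.ker ↔ 𝓘_{Ker φ} ≤ (G ×_S T ⟶ G).ker ↔ φ_T = 1_T` and the factorisation form («the locus where `φ` kills `G`», e.g.
  «`K ⊆ ker ψ`» for a finite flat subgroup `K` and `φ := ψ|_K`; F-10 (b), (h9) `K_m(λ) ⊆ A[m]`).

(`1_T` is written `(Over.pullback b).map 1`; rewrite to the unit of `G_T ⟶ H_T` for your group structure on `H_T` with Mathlib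
`Functor.map_one (Over.pullback b)`.)

## References
* [GortzWedhorn2020] U. Görtz, T. Wedhorn, *Algebraic Geometry I: Schemes*, 2nd ed. (2020): Definition 4.45 (2), p. 117 (kernel of a
  homomorphism of group schemes), Definition/Proposition 9.7 (ii) (equalisers into separated schemes are closed), Definition 12.18 and
  Proposition 12.19 (pp. 331–332) (finite locally free morphisms).
* [MumfordFogartyKirwan1994] D. Mumford, J. Fogarty, F. Kirwan, *Geometric Invariant Theory*, 3rd ed. (1994), Ch. 6 §3 Prop. 6.16 (p. 126).
-/

noncomputable section

-- `TopCat.Presheaf`/`Scheme.Modules` are not reducible (as in Mathlib's `AlgebraicGeometry/Modules`).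
set_option backward.isDefEq.respectTransparency false

open CategoryTheory CategoryTheory.Limits AlgebraicGeometry MonoidalCategory CartesianMonoidalCategory

universe u

namespace Literature.AlgebraicGeometry.GroupSchemes

open GroupSchemeKernel Literature.AlgebraicGeometry.Morphisms
open scoped MonObj

/-! ## §1 `φ = 1` iff `Ker φ ⟶ G` is an isomorphism; `Ker φ → S` finite -/

section General

variable {S : Scheme.{u}} {G H : Over S} [GrpObj H] (φ : G ⟶ H)

/-- **`φ = 1` iff the kernel inclusion `Ker φ ⟶ G` is an isomorphism** (then `kerLift (𝟙 G)` is its inverse; conversely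
`φ = (ι⁻¹ ≫ ι) ≫ φ = ι⁻¹ ≫ 1 = 1`). [cite: GortzWedhorn2020, Definition 4.45 (2), p. 117] -/
theorem eq_one_iff_isIso_kerι : φ = 1 ↔ IsIso (kerι φ) := by
  constructor
  · intro hφ
    refine ⟨⟨kerLift (𝟙 G) (by rw [Category.id_comp, hφ]), ?_, kerLift_ι _ _⟩⟩
    exact ker_hom_ext (by rw [Category.assoc, kerLift_ι, Category.id_comp, Category.comp_id])
  · intro h
    rw [← Category.id_comp φ, ← IsIso.inv_hom_id (kerι φ), Category.assoc, kerι_comp, MonObj.comp_one]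

/-- **`Ker φ → S` is finite** for `G → S` finite and `H → S` separated (`Ker φ ⟶ G` is then a closed immersion, ★
`isClosedImmersion_kerι_left_of_isSeparated`). [cite: GortzWedhorn2020, Definition 4.45 (2), p. 117] -/
theorem isFinite_ker_hom [IsFinite G.hom] [IsSeparated H.hom] : IsFinite (ker φ).hom := by
  haveI := isClosedImmersion_kerι_left_of_isSeparated φ
  rw [← Over.w (kerι φ)]
  infer_instance

/-- `Ker φ → S` is affine under the same hypotheses with `G → S` affine. [cite: GortzWedhorn2020, Definition 4.45 (2), p. 117] -/
theorem isAffineHom_ker_hom [IsAffineHom G.hom] [IsSeparated H.hom] : IsAffineHom (ker φ).hom := by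
  haveI := isClosedImmersion_kerι_left_of_isSeparated φ
  rw [← Over.w (kerι φ)]
  infer_instance

end General

/-! ## §2 `Ker φ` and `Eq(φ, 1)` cut the same ideal sheaf; «`φ_T = 1_T`» ⟺ «`G_T ⊆ (Ker φ)_T`» -/

section Ideal

variable {S : Scheme.{u}} {G H : Over S} [GrpObj H] (φ : G ⟶ H)

/-- A morphism of schemes `h : W ⟶ G` factors through `Ker φ` iff `h ≫ φ = h ≫ 1` (as `S`-morphisms, `W` over `S` via
`h ≫ (G → S)`): the functor of points of the kernel, in the equaliser form. [cite: GortzWedhorn2020, Definition 4.45 (2), p. 117] -/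
theorem exists_comp_kerι_left_eq_iff {W : Scheme.{u}} (h : W ⟶ G.left) :
    (∃ k : W ⟶ (ker φ).left, k ≫ (kerι φ).left = h) ↔ h ≫ φ.left = h ≫ (1 : G ⟶ H).left := by
  rw [← exists_comp_equalizer_ι_eq_iff]
  let W' : Over S := Over.mk (h ≫ G.hom)
  let h' : W' ⟶ G := Over.homMk h rfl
  constructor
  · rintro ⟨k, hk⟩
    -- `h ≫ φ = k ≫ ι ≫ φ = k ≫ 1`, and `h ≫ 1`: compare in `Over S` through `h'`
    have hkφ : h ≫ φ.left = h ≫ (1 : G ⟶ H).left := by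
      have e1 : (h' ≫ φ).left = (h' ≫ (1 : G ⟶ H)).left := by
        rw [MonObj.comp_one]
        -- `h' = k' ≫ kerι φ` in `Over S`
        let k' : W' ⟶ ker φ := Over.homMk k (by
          change k ≫ (ker φ).hom = h ≫ G.hom
          rw [← Over.w (kerι φ), ← Category.assoc, hk])
        have hk' : k' ≫ kerι φ = h' := Over.OverMorphism.ext hk
        rw [← hk', Category.assoc, kerι_comp, MonObj.comp_one]
      exact e1
    exact (exists_comp_equalizer_ι_eq_iff φ 1 h).2 hkφ
  · intro hex
    have hφ1 : h ≫ φ.left = h ≫ (1 : G ⟶ H).left := (exists_comp_equalizer_ι_eq_iff φ 1 h).1 hex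
    have hφ1' : h' ≫ φ = 1 := by
      have : h' ≫ φ = h' ≫ (1 : G ⟶ H) := Over.OverMorphism.ext hφ1
      rw [this, MonObj.comp_one]
    exact ⟨(kerLift h' hφ1').left, congrArg Over.Hom.left (kerLift_ι h' hφ1')⟩

/-- **`Ker φ` and `Eq(φ, 1)` have the same ideal sheaf in `G`** (`H → S` separated, so both are closed subschemes of `G`;
two closed immersions with the same functor of points cut the same ideal sheaf). [cite: GortzWedhorn2020, Definition 4.45 (2), p. 117]
[cite: GortzWedhorn2020, Definition/Proposition 9.7 (ii)] -/
theorem kerι_ker_eq_equalizer_ι_ker [IsSeparated H.hom] :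
    (kerι φ).left.ker = (equalizer.ι φ (1 : G ⟶ H)).left.ker := by
  haveI := isClosedImmersion_kerι_left_of_isSeparated φ
  refine idealSheafData_eq_of_forall_le_ker_iff fun W h => ?_
  rw [← comp_eq_comp_iff_ker_equalizer_ι_le, ← exists_comp_kerι_left_eq_iff]
  constructor
  · intro hle
    exact ⟨IsClosedImmersion.lift (kerι φ).left h hle, IsClosedImmersion.lift_fac _ _ _⟩
  · rintro ⟨k, rfl⟩
    exact Scheme.Hom.le_ker_comp _ _

/-- **«`φ_T = 1_T`» ⟺ «`G_T ⊆ (Ker φ)_T`»**: the base changes of `φ` and `1` along `b : T ⟶ S` agree iff the projection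
`G ×_S T ⟶ G` kills the ideal sheaf of `Ker φ` (★ `EqualizerLocusClosed.pullback_map_eq_iff_ker_equalizer_ι_le` + §2).
[cite: GortzWedhorn2020, Definition 4.45 (2), p. 117] [cite: GortzWedhorn2020, Definition/Proposition 9.7 (ii)] -/
theorem pullback_map_eq_map_one_iff_kerι_ker_le [IsSeparated H.hom] {T : Scheme.{u}} (b : T ⟶ S) :
    (Over.pullback b).map φ = (Over.pullback b).map (1 : G ⟶ H) ↔ (kerι φ).left.ker ≤ (pullback.fst G.hom b).ker := by
  rw [kerι_ker_eq_equalizer_ι_ker, pullback_map_eq_iff_ker_equalizer_ι_le]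

/-- Globally: `φ = 1` iff the ideal sheaf of the closed subscheme `Ker φ ⊆ G` vanishes (Mathlib `IsClosedImmersion.isIso_iff_ker_eq_bot`).
[cite: GortzWedhorn2020, Definition 4.45 (2), p. 117] -/
theorem eq_one_iff_kerι_ker_eq_bot [IsSeparated H.hom] : φ = 1 ↔ (kerι φ).left.ker = ⊥ := by
  haveI := isClosedImmersion_kerι_left_of_isSeparated φ
  rw [eq_one_iff_isIso_kerι, ← IsClosedImmersion.isIso_iff_ker_eq_bot]
  constructor
  · intro h
    infer_instance
  · intro h
    haveI : IsIso ((Over.forget S).map (kerι φ)) := h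
    exact isIso_of_reflects_iso (kerι φ) (Over.forget S)

end Ideal

/-! ## §3 The locus where `φ` kills `G`, for a finite flat source -/

section Locus

variable {S : Scheme.{u}} {G H : Over S} [GrpObj H] (φ : G ⟶ H)

/-- **«`φ` kills `G`» / «`G ⊆ Ker φ`» is ONE closed subscheme `V(E)` of the base**, for `G → S` finite and flat over a locally
noetherian `S` and `H → S` separated: `E ≤ b.ker ↔ 𝓘_{Ker φ} ≤ (G ×_S T ⟶ G).ker ↔ φ_T = 1_T`, with the factorisation form.
(★ `ContainmentLocusFiniteFlat` at `Z := Ker φ`; e.g. «`K ⊆ Ker ψ`» for a finite flat subgroup scheme `K` and `φ := ψ|_K`.)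
[cite: MumfordFogartyKirwan1994, Ch. 6 §3 Prop. 6.16 (p. 126)] [cite: GortzWedhorn2020, Definition 12.18 and Proposition 12.19 (pp. 331–332)] -/
theorem exists_idealSheafData_iff_kerι_ker_le_of_isFinite_of_flat [IsFinite G.hom] [Flat G.hom] [IsLocallyNoetherian S]
    [IsSeparated H.hom] :
    ∃ E : S.IdealSheafData, ∀ ⦃T : Scheme.{u}⦄ (b : T ⟶ S),
      (E ≤ b.ker ↔ (kerι φ).left.ker ≤ (pullback.fst G.hom b).ker) ∧
      (E ≤ b.ker ↔ (Over.pullback b).map φ = (Over.pullback b).map (1 : G ⟶ H)) ∧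
      ((∃ b' : T ⟶ E.subscheme, b' ≫ E.subschemeι = b) ↔
        (Over.pullback b).map φ = (Over.pullback b).map (1 : G ⟶ H)) := by
  obtain ⟨E, hE⟩ := exists_idealSheafData_le_ker_iff_le_ker_fst_of_finite_projective_app G.hom (kerι φ).left.ker
    (finite_projective_app_of_isFinite_of_flat G.hom)
  have hE' : ∀ ⦃T : Scheme.{u}⦄ (b : T ⟶ S),
      E ≤ b.ker ↔ (equalizer.ι φ (1 : G ⟶ H)).left.ker ≤ (pullback.fst G.hom b).ker := fun T b => by
    rw [← kerι_ker_eq_equalizer_ι_ker]; exact hE b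
  exact ⟨E, fun T b => ⟨hE b, le_ker_iff_pullback_map_eq_of_containment φ 1 E hE' b,
    exists_comp_subschemeι_eq_iff_pullback_map_eq_of_containment φ 1 E hE' b⟩⟩

/-- The same for `G → S` affine with finite projective affine charts (any base). [cite: MumfordFogartyKirwan1994, Ch. 6 §3 Prop. 6.16 (p. 126)]
[cite: GortzWedhorn2020, Definition 12.18 and Proposition 12.19 (pp. 331–332)] -/
theorem exists_idealSheafData_iff_kerι_ker_le_of_finite_projective_app [IsAffineHom G.hom]
    (hp : ∀ s : S, ∃ W : S.Opens, s ∈ W ∧ IsAffineOpen W ∧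
      letI := (G.hom.app W).hom.toAlgebra
      Module.Finite Γ(S, W) Γ(G.left, G.hom ⁻¹ᵁ W) ∧ Module.Projective Γ(S, W) Γ(G.left, G.hom ⁻¹ᵁ W))
    [IsSeparated H.hom] :
    ∃ E : S.IdealSheafData, ∀ ⦃T : Scheme.{u}⦄ (b : T ⟶ S),
      (E ≤ b.ker ↔ (kerι φ).left.ker ≤ (pullback.fst G.hom b).ker) ∧
      (E ≤ b.ker ↔ (Over.pullback b).map φ = (Over.pullback b).map (1 : G ⟶ H)) ∧
      ((∃ b' : T ⟶ E.subscheme, b' ≫ E.subschemeι = b) ↔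
        (Over.pullback b).map φ = (Over.pullback b).map (1 : G ⟶ H)) := by
  obtain ⟨E, hE⟩ := exists_idealSheafData_le_ker_iff_le_ker_fst_of_finite_projective_app G.hom (kerι φ).left.ker hp
  have hE' : ∀ ⦃T : Scheme.{u}⦄ (b : T ⟶ S),
      E ≤ b.ker ↔ (equalizer.ι φ (1 : G ⟶ H)).left.ker ≤ (pullback.fst G.hom b).ker := fun T b => by
    rw [← kerι_ker_eq_equalizer_ι_ker]; exact hE b
  exact ⟨E, fun T b => ⟨hE b, le_ker_iff_pullback_map_eq_of_containment φ 1 E hE' b,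
    exists_comp_subschemeι_eq_iff_pullback_map_eq_of_containment φ 1 E hE' b⟩⟩

end Locus

end Literature.AlgebraicGeometry.GroupSchemes

end
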